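import Literature.NumberTheory.Sieve.CFSemigroupPressure
import HarnessLib

/-!
# The transfer operator of the continued-fractions semigroup and its growth rate

Support file (all results proved) for the named fact
`Literature.NumberTheory.Sieve.MageeOhWinter2019_uniformCounting` (`CFSemigroupCounting.lean`).
[MageeOhWinter2019, §2.2] introduces, for the expanding map `T` of `Γ_A` and the distortion
function `τ = log |T'|`, the transfer operators `L_s = L_{-sτ}`,
`(L_s f)(x) = Σ_{T y = x} |T'(y)|^{-s} f(y)`, whose leading eigenvalue is `e^{P(-sτ)}`
(Ruelle–Perron–Frobenius, Thm. 10). For the continued fractions semigroup the inverse branches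
of `T` are the Möbius maps `g_a(x) = 1/(a + x)`, `a ∈ A`, with `|g_a'(x)| = (a + x)^{-2}`, so
`(L_s f)(x) = Σ_{a ∈ A} (a + x)^{-2s} f(1/(a + x))` (`cfTransfer`). We prove:

* `cfTransfer_iterate`: `(L_sⁿ f)(x) = Σ_{w ∈ Aⁿ} (q'(w) x + q(w))^{-2s} f(M_w · x)` — the iterates
  are sums over the word matrices `M_w = g_{w₁} ⋯ g_{wₙ} = (p' p; q' q)` acting projectively
  (`cfMoeb`), with the derivative cocycle `cfDenom_mul`;
* `cfTransfer_iterate_one_le`, `le_cfTransfer_iterate_one`: bounded distortion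
  `4^{-s} Z_n(s) ≤ (L_sⁿ 1)(x) ≤ Z_n(s)` on `[0, 1]` (`Z_n(s) = Σ_{w ∈ Aⁿ} q(w)^{-2s}`, the
  partition function of `CFSemigroupPressure.lean`);
* `tendsto_log_cfTransfer_iterate_one`: `(1/n) log (L_sⁿ 1)(x) → P_A(s)` uniformly in
  `x ∈ [0,1]` — the growth rate (spectral radius on `C[0,1]`, Gelfand form) of `L_s` is
  `e^{P_A(s)}`, the "maximal eigenvalue `e^{P(f)}`" of [MageeOhWinter2019, Thm. 10 (2)].

## References

* M. Magee, H. Oh, D. Winter, J. reine angew. Math. 753 (2019) 89–135, §2.1 eq. (2.1), §2.2,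
  Thm. 10. [MageeOhWinter2019]
* D. Hensley, J. Number Theory 40 (1992) 336–358, §2 (the operators `L_s` for `E_A`).
-/

noncomputable section

open Filter Set
open scoped Topology

namespace Literature.NumberTheory.Sieve

/-! ### Projective action and the derivative cocycle of nonnegative integer matrices -/

/-- The projective (Möbius) action `M · x = (M₀₀ x + M₀₁)/(M₁₀ x + M₁₁)` of an integer matrix on
`ℝ`. [cite: MageeOhWinter2019, §2.1] -/
def cfMoeb (M : Matrix (Fin 2) (Fin 2) ℤ) (x : ℝ) : ℝ :=
  ((M 0 0 : ℝ) * x + M 0 1) / ((M 1 0 : ℝ) * x + M 1 1)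

/-- The denominator `M₁₀ x + M₁₁` of the action (`|M'(x)| = (M₁₀ x + M₁₁)^{-2}` when
`det M = ±1`). [cite: MageeOhWinter2019, §2.1 eq. (2.1)] -/
def cfDenom (M : Matrix (Fin 2) (Fin 2) ℤ) (x : ℝ) : ℝ := (M 1 0 : ℝ) * x + M 1 1

/-- `g_a · x = 1/(a + x)`. [cite: MageeOhWinter2019, §2.1] -/
theorem cfMoeb_cfGen (a : ℕ) (x : ℝ) : cfMoeb (cfGen a) x = 1 / (x + a) := by
  simp [cfMoeb, cfGen]

/-- The denominator of `g_a` at `x` is `x + a`. [folklore] -/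
theorem cfDenom_cfGen (a : ℕ) (x : ℝ) : cfDenom (cfGen a) x = x + a := by
  simp [cfDenom, cfGen]

/-- **The derivative cocycle:** `denom(M N, x) = denom(N, x) · denom(M, N · x)` whenever
`denom(N, x) ≠ 0` (chain rule for `|(MN)'| = |M'(N x)| |N'(x)|`). [folklore] -/
theorem cfDenom_mul (M N : Matrix (Fin 2) (Fin 2) ℤ) {x : ℝ} (hN : cfDenom N x ≠ 0) :
    cfDenom (M * N) x = cfDenom N x * cfDenom M (cfMoeb N x) := by
  simp only [cfDenom, cfMoeb, Matrix.mul_apply, Fin.sum_univ_two, Int.cast_add, Int.cast_mul]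
  unfold cfDenom at hN
  field_simp
  ring

/-- **The action is a left action:** `(M N) · x = M · (N · x)` whenever the denominators do not
vanish. [folklore] -/
theorem cfMoeb_mul (M N : Matrix (Fin 2) (Fin 2) ℤ) {x : ℝ} (hN : cfDenom N x ≠ 0)
    (hMN : cfDenom M (cfMoeb N x) ≠ 0) : cfMoeb (M * N) x = cfMoeb M (cfMoeb N x) := by
  have hden := cfDenom_mul M N hN
  simp only [cfDenom, cfMoeb, Matrix.mul_apply, Fin.sum_univ_two, Int.cast_add, Int.cast_mul]
    at hN hMN hden ⊢
  rw [div_eq_div_iff (by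
    rw [show ((M 1 0 : ℝ) * N 0 0 + M 1 1 * N 1 0) * x + (M 1 0 * N 0 1 + M 1 1 * N 1 1) =
      ((N 1 0 : ℝ) * x + N 1 1) * (M 1 0 * ((N 0 0 * x + N 0 1) / (N 1 0 * x + N 1 1)) + M 1 1)
      from hden]
    exact mul_ne_zero hN hMN) hMN]
  field_simp
  ring

/-! ### Word matrices acting on `[0, 1]` -/

variable {A : Finset ℕ} {n : ℕ}

/-- For a word matrix with digits `≥ 1` and `x ∈ [0,1]`: `q(w) ≤ denom(M_w, x) ≤ 2 q(w)`
(bounded distortion, `0 ≤ q' ≤ q`). [cite: MageeOhWinter2019, §2.1 eq. (2.1)] -/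
theorem cfDenom_cfMat_mem {w : Fin n → ℕ} (hw : ∀ i, 1 ≤ w i) {x : ℝ} (hx : x ∈ Icc (0 : ℝ) 1) :
    (cfQ w : ℝ) ≤ cfDenom (cfMat w) x ∧ cfDenom (cfMat w) x ≤ 2 * (cfQ w : ℝ) := by
  have hd := one_le_cfExt hw
  have h10 : (0 : ℝ) ≤ (cfMat w 1 0 : ℝ) := by exact_mod_cast cfWord_nonneg _ _ 1 0
  have h10q : (cfMat w 1 0 : ℝ) ≤ (cfMat w 1 1 : ℝ) := by
    have := cfWord_10_le_cfDen hd n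
    exact_mod_cast this
  simp only [cfDenom, cfQ_eq]
  constructor <;> nlinarith [hx.1, hx.2]

/-- Word matrices map `[0,1]` into `[0,1]`. [cite: MageeOhWinter2019, §2.1] -/
theorem cfMoeb_cfMat_mem {w : Fin n → ℕ} (hw : ∀ i, 1 ≤ w i) {x : ℝ} (hx : x ∈ Icc (0 : ℝ) 1) :
    cfMoeb (cfMat w) x ∈ Icc (0 : ℝ) 1 := by
  rcases n with _ | m
  · simpa [cfMoeb, cfMat] using hx
  have hd := one_le_cfExt hw
  have h00 : (0 : ℝ) ≤ (cfMat w 0 0 : ℝ) := by exact_mod_cast cfWord_nonneg _ _ 0 0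
  have h01 : (0 : ℝ) ≤ (cfMat w 0 1 : ℝ) := by exact_mod_cast cfWord_nonneg _ _ 0 1
  have hq1 : (1 : ℝ) ≤ (cfQ w : ℝ) := by exact_mod_cast one_le_cfQ hw
  have hden := (cfDenom_cfMat_mem hw hx).1
  simp only [cfDenom] at hden
  -- numerator entries are dominated by denominator entries
  have hrow : (cfMat w 0 0 : ℝ) ≤ cfMat w 1 0 ∧ (cfMat w 0 1 : ℝ) ≤ cfMat w 1 1 := by
    obtain ⟨h1, h2⟩ := cfWord_fst_le_snd hd m
    exact ⟨by exact_mod_cast h1, by exact_mod_cast h2⟩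
  have hpos : (0 : ℝ) < (cfMat w 1 0 : ℝ) * x + cfMat w 1 1 := by linarith
  simp only [cfMoeb]
  refine ⟨div_nonneg (by nlinarith [hx.1]) hpos.le, ?_⟩
  rw [div_le_one hpos]
  nlinarith [hx.1, hrow.1, hrow.2]

/-- The denominator of a word matrix at `x ∈ [0,1]` is positive. [folklore] -/
theorem cfDenom_cfMat_pos {w : Fin n → ℕ} (hw : ∀ i, 1 ≤ w i) {x : ℝ} (hx : x ∈ Icc (0 : ℝ) 1) :
    0 < cfDenom (cfMat w) x := by
  have hq1 : (1 : ℝ) ≤ (cfQ w : ℝ) := by exact_mod_cast one_le_cfQ hw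
  linarith [(cfDenom_cfMat_mem hw hx).1]

/-- `g_a` maps `[0,1]` into `[0,1]` (`a ≥ 1`). [cite: MageeOhWinter2019, §2.1] -/
theorem one_div_add_mem_Icc {a : ℕ} (ha : 1 ≤ a) {x : ℝ} (hx : x ∈ Icc (0 : ℝ) 1) :
    1 / (x + a) ∈ Icc (0 : ℝ) 1 := by
  have h1 : (1 : ℝ) ≤ a := by exact_mod_cast ha
  have hxa : 1 ≤ x + a := by linarith [hx.1]
  exact ⟨by positivity, (div_le_one (by linarith)).2 hxa⟩

/-! ### The transfer operator -/

variable (A) in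
/-- The **transfer operator** `(L_s f)(x) = Σ_{a ∈ A} (a + x)^{-2s} f(1/(a + x))` of the
continued fractions semigroup (`= Σ_{T y = x} |T'(y)|^{-s} f(y)`, the operator `L_{-sτ}` of
[MageeOhWinter2019, §2.2], written with `((x + a)²)^{-s}`). [cite: MageeOhWinter2019, §2.2] -/
def cfTransfer (s : ℝ) (f : ℝ → ℝ) (x : ℝ) : ℝ :=
  ∑ a ∈ A, ((x + a) ^ 2) ^ (-s) * f (1 / (x + a))

/-- The word-sum form of the iterates: `W_n f (x) = Σ_{w ∈ Aⁿ} denom(M_w, x)^{-2s} f(M_w · x)`.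
[folklore] -/
def cfTransferSum (A : Finset ℕ) (s : ℝ) (n : ℕ) (f : ℝ → ℝ) (x : ℝ) : ℝ :=
  ∑ w : Fin n → A, ((cfDenom (cfMat fun i => (w i : ℕ)) x) ^ 2) ^ (-s) *
    f (cfMoeb (cfMat fun i => (w i : ℕ)) x)

/-- `W_0 f = f`. [folklore] -/
theorem cfTransferSum_zero (s : ℝ) (f : ℝ → ℝ) (x : ℝ) : cfTransferSum A s 0 f x = f x := by
  simp [cfTransferSum, cfDenom, cfMoeb, cfMat]

/-- A one-letter word matrix is the generator. [folklore] -/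
theorem cfMat_fin_one (v : Fin 1 → ℕ) : cfMat v = cfGen (v 0) := by
  simp [cfMat, cfWord_succ, cfExt_of_lt]

/-- **The iterates of the transfer operator are word sums:** `L_sⁿ f = W_n f` on `[0,1]`
(induction on `n`, splitting off the last letter: `M_{wa} = M_w g_a`, chain rule `cfDenom_mul`).
[cite: MageeOhWinter2019, §2.2] -/
theorem cfTransfer_iterate (hA : ∀ a ∈ A, 1 ≤ a) (s : ℝ) (f : ℝ → ℝ) :
    ∀ (n : ℕ) {x : ℝ}, x ∈ Icc (0 : ℝ) 1 → (cfTransfer A s)^[n] f x = cfTransferSum A s n f x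
  | 0, x, _ => by rw [Function.iterate_zero, id, cfTransferSum_zero]
  | n + 1, x, hx => by
      rw [Function.iterate_succ_apply', cfTransfer,
        Finset.sum_congr rfl fun a ha => by rw [cfTransfer_iterate hA s f n (one_div_add_mem_Icc (hA a ha) hx)]]
      rw [cfTransferSum, ← (Fin.appendEquiv n 1).sum_comp, Fintype.sum_prod_type, Finset.sum_comm,
        ← Finset.sum_coe_sort A, ← (Equiv.funUnique (Fin 1) A).sum_comp]
      refine Finset.sum_congr rfl fun v _ => ?_
      rw [cfTransferSum, Finset.mul_sum]
      refine Finset.sum_congr rfl fun w _ => ?_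
      simp only [Fin.appendEquiv_apply, Equiv.funUnique_apply, Fin.default_eq_zero]
      rw [coe_append, cfMat_append, cfMat_fin_one]
      have hw : ∀ i, 1 ≤ (fun i => (w i : ℕ)) i := one_le_coe_digit hA w
      have ha1 : (1 : ℝ) ≤ ((v 0 : A) : ℕ) := by exact_mod_cast hA _ (v 0).2
      have hxa : cfDenom (cfGen ((v 0 : A) : ℕ)) x ≠ 0 := by
        rw [cfDenom_cfGen]
        linarith [hx.1]
      have hy : cfMoeb (cfGen ((v 0 : A) : ℕ)) x ∈ Icc (0 : ℝ) 1 := by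
        rw [cfMoeb_cfGen]
        exact one_div_add_mem_Icc (hA _ (v 0).2) hx
      have hM : cfDenom (cfMat fun i => (w i : ℕ)) (cfMoeb (cfGen ((v 0 : A) : ℕ)) x) ≠ 0 :=
        (cfDenom_cfMat_pos hw hy).ne'
      rw [cfDenom_mul _ _ hxa, cfMoeb_mul _ _ hxa hM, cfMoeb_cfGen, cfDenom_cfGen, mul_pow,
        Real.mul_rpow (sq_nonneg _) (sq_nonneg _)]
      ring


/-! ### Bounded distortion: `L_sⁿ 1 ≍ Z_n(s)` and the growth rate `e^{P_A(s)}` -/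

section Growth

variable (hA : ∀ a ∈ A, 1 ≤ a)
include hA

/-- **Upper distortion bound:** `(W_n 1)(x) ≤ Z_n(s)` for `x ∈ [0,1]`, `s ≥ 0`
(`denom(M_w, x) ≥ q(w)`). [cite: MageeOhWinter2019, §2.1 eq. (2.1)] -/
theorem cfTransferSum_one_le {s : ℝ} (hs : 0 ≤ s) (n : ℕ) {x : ℝ} (hx : x ∈ Icc (0 : ℝ) 1) :
    cfTransferSum A s n (fun _ => 1) x ≤ cfPartition A n s := by
  rw [cfTransferSum, cfPartition]
  refine Finset.sum_le_sum fun w _ => ?_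
  have hw : ∀ i, 1 ≤ (fun i => (w i : ℕ)) i := one_le_coe_digit hA w
  have hq1 : (1 : ℝ) ≤ (cfQ (fun i => (w i : ℕ)) : ℝ) := by exact_mod_cast one_le_cfQ hw
  have hden := (cfDenom_cfMat_mem hw hx).1
  rw [mul_one]
  exact Real.rpow_le_rpow_of_nonpos (by positivity) (pow_le_pow_left₀ (by positivity) hden 2)
    (by linarith)

/-- **Lower distortion bound:** `4^{-s} Z_n(s) ≤ (W_n 1)(x)` for `x ∈ [0,1]`, `s ≥ 0`
(`denom(M_w, x) ≤ 2 q(w)`). [cite: MageeOhWinter2019, §2.1 eq. (2.1)] -/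
theorem le_cfTransferSum_one {s : ℝ} (hs : 0 ≤ s) (n : ℕ) {x : ℝ} (hx : x ∈ Icc (0 : ℝ) 1) :
    (4 : ℝ) ^ (-s) * cfPartition A n s ≤ cfTransferSum A s n (fun _ => 1) x := by
  rw [cfTransferSum, cfPartition, Finset.mul_sum]
  refine Finset.sum_le_sum fun w _ => ?_
  have hw : ∀ i, 1 ≤ (fun i => (w i : ℕ)) i := one_le_coe_digit hA w
  have hq1 : (1 : ℝ) ≤ (cfQ (fun i => (w i : ℕ)) : ℝ) := by exact_mod_cast one_le_cfQ hw
  obtain ⟨hden1, hden2⟩ := cfDenom_cfMat_mem hw hx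
  rw [mul_one, ← Real.mul_rpow (by norm_num) (by positivity)]
  have hdenpos : 0 < cfDenom (cfMat fun i => (w i : ℕ)) x := by linarith
  refine Real.rpow_le_rpow_of_nonpos (pow_pos hdenpos 2) ?_ (by linarith)
  nlinarith

/-- `L_sⁿ 1 (x) ≤ Z_n(s)` on `[0,1]`. [cite: MageeOhWinter2019, §2.2] -/
theorem cfTransfer_iterate_one_le {s : ℝ} (hs : 0 ≤ s) (n : ℕ) {x : ℝ} (hx : x ∈ Icc (0 : ℝ) 1) :
    (cfTransfer A s)^[n] (fun _ => 1) x ≤ cfPartition A n s := by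
  rw [cfTransfer_iterate hA s _ n hx]
  exact cfTransferSum_one_le hA hs n hx

/-- `4^{-s} Z_n(s) ≤ L_sⁿ 1 (x)` on `[0,1]`. [cite: MageeOhWinter2019, §2.2] -/
theorem le_cfTransfer_iterate_one {s : ℝ} (hs : 0 ≤ s) (n : ℕ) {x : ℝ} (hx : x ∈ Icc (0 : ℝ) 1) :
    (4 : ℝ) ^ (-s) * cfPartition A n s ≤ (cfTransfer A s)^[n] (fun _ => 1) x := by
  rw [cfTransfer_iterate hA s _ n hx]
  exact le_cfTransferSum_one hA hs n hx

/-- `L_sⁿ 1 (x) > 0` on `[0,1]` (`A ≠ ∅`). [folklore] -/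
theorem cfTransfer_iterate_one_pos (hne : A.Nonempty) {s : ℝ} (hs : 0 ≤ s) (n : ℕ) {x : ℝ}
    (hx : x ∈ Icc (0 : ℝ) 1) : 0 < (cfTransfer A s)^[n] (fun _ => 1) x :=
  lt_of_lt_of_le (mul_pos (Real.rpow_pos_of_pos (by norm_num) _) (cfPartition_pos hA hne n s))
    (le_cfTransfer_iterate_one hA hs n hx)

/-- **Uniform comparison with the partition function:**
`|log L_sⁿ1(x) - log Z_n(s)| ≤ s log 4` for all `x ∈ [0,1]`, `n`. [folklore] -/
theorem abs_log_cfTransfer_iterate_one_sub_le (hne : A.Nonempty) {s : ℝ} (hs : 0 ≤ s) (n : ℕ)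
    {x : ℝ} (hx : x ∈ Icc (0 : ℝ) 1) :
    |Real.log ((cfTransfer A s)^[n] (fun _ => 1) x) - Real.log (cfPartition A n s)| ≤
      s * Real.log 4 := by
  have hZ := cfPartition_pos hA hne n s
  have hL := cfTransfer_iterate_one_pos hA hne hs n hx
  have h1 := Real.log_le_log hL (cfTransfer_iterate_one_le hA hs n hx)
  have h2 := Real.log_le_log (by positivity) (le_cfTransfer_iterate_one hA hs n hx)
  rw [Real.log_mul (Real.rpow_pos_of_pos (by norm_num) _).ne' hZ.ne', Real.log_rpow (by norm_num)]
    at h2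
  have hlog4 : 0 ≤ Real.log 4 := Real.log_nonneg (by norm_num)
  rw [abs_le]
  constructor <;> nlinarith

/-- **The growth rate of the transfer operator is the pressure** (the leading eigenvalue
`e^{P(-sτ)}` of [MageeOhWinter2019, Thm. 10 (2)], in Gelfand form on the unit interval):
`(1/n) log (L_sⁿ 1)(x) → P_A(s)` for every `x ∈ [0,1]` (`s ≥ 0`; the convergence is uniform in
`x` by `abs_log_cfTransfer_iterate_one_sub_le`). [cite: MageeOhWinter2019, Thm. 10] -/
theorem tendsto_log_cfTransfer_iterate_one (hne : A.Nonempty) {s : ℝ} (hs : 0 ≤ s) {x : ℝ}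
    (hx : x ∈ Icc (0 : ℝ) 1) :
    Tendsto (fun n : ℕ => Real.log ((cfTransfer A s)^[n] (fun _ => 1) x) / n) atTop
      (𝓝 (cfPressure A s)) := by
  have hP := tendsto_cfPressure hA hne hs
  have h0 : Tendsto (fun n : ℕ => s * Real.log 4 / (n : ℝ)) atTop (𝓝 0) :=
    tendsto_const_div_atTop_nhds_zero_nat _
  -- squeeze `|a_n - b_n| ≤ c/n`
  have hdiff : Tendsto (fun n : ℕ => Real.log ((cfTransfer A s)^[n] (fun _ => 1) x) / n -
      Real.log (cfPartition A n s) / n) atTop (𝓝 0) := by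
    refine squeeze_zero_norm (fun n => ?_) h0
    rw [Real.norm_eq_abs, ← sub_div, abs_div]
    rcases Nat.eq_zero_or_pos n with rfl | hn
    · simp
    · rw [abs_of_pos (by exact_mod_cast hn : (0 : ℝ) < n)]
      exact div_le_div_of_nonneg_right (abs_log_cfTransfer_iterate_one_sub_le hA hne hs n hx)
        (by positivity)
  have := hdiff.add hP
  rw [zero_add] at this
  exact this.congr fun n => by ring

end Growth

end Literature.NumberTheory.Sieve
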